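import Summits.QuantumFields.QCD.Theorems.HeatSlicedQuarksRobustYangMillsHandoverStubDiracMatrixSourceTimeSlice
import Literature.MathematicalPhysics.QuantumFieldTheory.QCDTransferMatrix
import HarnessLib

/-!
# Stub `stub_diracMatrix_multiSource_timeSlice` of line `pin-the-infimum`
(crux `RobustYangMillsHandover`, 8892)

E2 (fermionic insertions in Lüscher's transfer form), layer γ0-multi: **the `N_f`-flavour
Wilson–Dirac matrix with a FAMILY of equal-time sources, one per time slice, is a Wilson-type
projector chain whose every diagonal block is perturbed, `A_t − c_t • Jsl_t`.**

For an `SU(3)` gauge field `U` on the four-torus `(ℤ/L)⁴`, quark masses `mq : Fin Nf → ℝ`,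
coefficients `c : ℤ/L → ℂ` and sources `Jh t` (`t : ℤ/L`) given on Smit's slice index
`SliceQuarkVar Nf L = flavour × ((ℤ/L)³ × colour × spin)`, the determinant of
`diracMatrix U mq − Σ_t c_t J^{(t)}` — the torus-side source is block-diagonal in time (supported on
the equal times `x₀ = y₀`, coefficient `c x₀`, block `Jh x₀`), pulled back to the tree's linear index
`FermiIdx` along `quarkEquiv` — equals the determinant of the block matrix on
`ℤ/L × ((flavour × (ℤ/L)³) × colour × spin)` whose `(t, s)` block is

* `A_t − c_t • reindex e_Nf e_Nf (Jh t)` for `s = t` (`A_t` the flavour-block-diagonal slice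
  operator of the one-source stub, `e_Nf = (Equiv.prodAssoc flavour site (colour × spin)).symm` the
  re-association transporting Smit's index to the chain index),
* the forward temporal hop `−P⁻ W_t` for `s = t + 1` and the backward hop `−P⁺ W'_s` for
  `t = s + 1`, exactly as in the one-source stub `stub_diracMatrix_source_timeSlice`.

The two-source case of the programme (F4) is the instance `c = s₁ δ_{t₁} + s₂ δ_{t₂}`-style.
[cite: Luscher1977, pp. 283–292]; [cite: MontvayMunster1994, §5.1].

## Proof

Identical to the one-source stub: `det M = det (M.submatrix e e)` along the time/flavour splitting
`e (t, ((f, y), c)) = quarkEquiv (f, ((Fin.cons t y), c))` (`Matrix.det_submatrix_equiv_self`), then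
an entrywise identification.  The Dirac part is the one-source computation verbatim (the reusable
brick `StubDiracMatrixSourceTimeSlice.wilsonDirac_cons_apply`, hops collapsed by
`TimeSlice.spinLift_mul_colourLift`); the source part reads `(Fin.cons t y) 0 = t`,
`Fin.tail (Fin.cons t y) = y` on the torus side and
`reindex e_Nf e_Nf (Jh t) ((f,y),cs) ((g,z),cs') = Jh t (f,(y,cs)) (g,(z,cs'))` on the chain side,
after which only the scalar bookkeeping `[s = t] u − h₁ − h₂ − [t = s] v = [s = t] (u − v) − h₁ − h₂`
remains (`StubDiracMatrixMultiSourceTimeSlice.multiSource_rearrange`).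

Pure theorem file (no definitions); Mathlib plus the landed one-source stub and the tree's
`StableActionBridge.Sketch` bricks.

References: M. Lüscher, *Construction of a selfadjoint, strictly positive transfer matrix for
Euclidean lattice gauge theories*, Comm. Math. Phys. 54 (1977) 283–292; I. Montvay, G. Münster,
*Quantum Fields on a Lattice* (CUP 1994), §4.2 (4.85), §5.1.
-/

namespace Summit.QuantumFields.QCD.Cruxes.RobustYangMillsHandover.PinTheInfimum

open Literature.MathematicalPhysics.QuantumLattice Literature.MathematicalPhysics.QuantumFieldTheory
open Literature.Probability.LatticeModels (TorusSite)
open Summit.QuantumFields.QCD.Cruxes.StableActionBridge.Sketch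

namespace StubDiracMatrixMultiSourceTimeSlice

/-- Scalar bookkeeping of the multi-source term: with `Q ↔ P`,
`[P] u − h₁ − h₂ − [Q] v = [P] (u − v) − h₁ − h₂`. [folklore] -/
theorem multiSource_rearrange {P Q : Prop} {_ : Decidable P} {_ : Decidable Q} (hQ : Q ↔ P)
    (u v h₁ h₂ : ℂ) :
    (if P then u else 0) - h₁ - h₂ - (if Q then v else 0) = (if P then u - v else 0) - h₁ - h₂ := by
  by_cases hP : P
  · rw [if_pos hP, if_pos hP, if_pos (hQ.2 hP)]; ring
  · rw [if_neg hP, if_neg hP, if_neg fun h => hP (hQ.1 h)]; ring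

/-- Entries of the re-associated source block: `reindex e_Nf e_Nf J ((f,y),cs) ((g,z),cs') =
J (f,(y,cs)) (g,(z,cs'))` for `e_Nf = (Equiv.prodAssoc _ _ _).symm`. [folklore] -/
theorem reindex_prodAssoc_symm_apply {α β γ : Type*} (J : Matrix (α × β × γ) (α × β × γ) ℂ)
    (f g : α) (y z : β) (cs cs' : γ) :
    Matrix.reindex (Equiv.prodAssoc α β γ).symm (Equiv.prodAssoc α β γ).symm J ((f, y), cs) ((g, z), cs') =
      J (f, (y, cs)) (g, (z, cs')) := rfl

end StubDiracMatrixMultiSourceTimeSlice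

/-- **E2 γ0-multi: the `N_f`-flavour Wilson–Dirac matrix with a family of equal-time sources is a
projector chain with slice operators `A_t − c_t • Jsl_t`.**  For an `SU(3)` gauge field `U` on
`(ℤ/L)⁴`, masses `mq`, coefficients `c : ℤ/L → ℂ` and source blocks `Jh t` on Smit's slice index
`flavour × ((ℤ/L)³ × colour × spin)`, `det (diracMatrix U mq − Σ_t c_t J^{(t)})` (the torus-side
source supported on the equal times `x₀ = y₀`, with coefficient `c x₀` and block `Jh x₀`) is the
determinant of the Wilson-type projector chain on `ℤ/L × ((flavour × (ℤ/L)³) × colour × spin)` with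
the flavour-block-diagonal slice operators `A_t` of the one-source stub, flavour- and spin-blind
transporters `W_t = ρ(U((t,·),0))`, `W'_t = ρ(U((t,·),0))⁻¹`, lifted projections `P± = ½(1 ± γ₀)`,
and EVERY diagonal block perturbed to `A_t − c_t • reindex e_Nf e_Nf (Jh t)`,
`e_Nf = (Equiv.prodAssoc flavour site (colour × spin)).symm`.  The statement is the registered stub
signature verbatim. [cite: Luscher1977, pp. 283–292] -/
theorem stub_diracMatrix_multiSource_timeSlice :
    ∀ (Nf L : ℕ) [NeZero L] (U : GaugeConfig 4 L (Matrix.specialUnitaryGroup (Fin 3) ℂ)) (mq : Fin Nf → ℝ)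
      (c : ZMod L → ℂ) (Jh : ZMod L → Matrix (SliceQuarkVar Nf L) (SliceQuarkVar Nf L) ℂ),
      let Pp : Matrix ((Fin Nf × TorusSite 3 L) × Fin 3 × Fin 4) ((Fin Nf × TorusSite 3 L) × Fin 3 × Fin 4) ℂ :=
        Matrix.of fun a b => if a.1 = b.1 ∧ a.2.1 = b.2.1 then ((1 / 2 : ℂ) • (1 + euclideanGamma 0)) a.2.2 b.2.2 else 0;
      let Pm : Matrix ((Fin Nf × TorusSite 3 L) × Fin 3 × Fin 4) ((Fin Nf × TorusSite 3 L) × Fin 3 × Fin 4) ℂ :=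
        Matrix.of fun a b => if a.1 = b.1 ∧ a.2.1 = b.2.1 then ((1 / 2 : ℂ) • (1 - euclideanGamma 0)) a.2.2 b.2.2 else 0;
      let W : ZMod L → Matrix ((Fin Nf × TorusSite 3 L) × Fin 3 × Fin 4) ((Fin Nf × TorusSite 3 L) × Fin 3 × Fin 4) ℂ :=
        fun t => Matrix.of fun a b => if a.1 = b.1 ∧ a.2.2 = b.2.2 then
          fundamentalRep (Fin 3) (U ((Fin.cons t a.1.2 : TorusSite 4 L), 0)) a.2.1 b.2.1 else 0;
      let W' : ZMod L → Matrix ((Fin Nf × TorusSite 3 L) × Fin 3 × Fin 4) ((Fin Nf × TorusSite 3 L) × Fin 3 × Fin 4) ℂ :=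
        fun t => Matrix.of fun a b => if a.1 = b.1 ∧ a.2.2 = b.2.2 then
          fundamentalRep (Fin 3) (U ((Fin.cons t a.1.2 : TorusSite 4 L), 0))⁻¹ a.2.1 b.2.1 else 0;
      let A : ZMod L → Matrix ((Fin Nf × TorusSite 3 L) × Fin 3 × Fin 4) ((Fin Nf × TorusSite 3 L) × Fin 3 × Fin 4) ℂ :=
        fun t => Matrix.of fun a b => if a.1.1 = b.1.1 then
          ((if a = b then ((mq a.1.1 + 4 * 1 : ℝ) : ℂ) else 0) -
            (1 / 2 : ℂ) * ∑ j : Fin 3,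
              ((if b.1.2 = Literature.MathematicalPhysics.QuantumFieldTheory.Site.shift a.1.2 j then
                  (((1 : ℝ) : ℂ) • (1 : Matrix (Fin 4) (Fin 4) ℂ) - euclideanGamma j.succ) a.2.2 b.2.2 *
                    fundamentalRep (Fin 3) (U ((Fin.cons t a.1.2 : TorusSite 4 L), j.succ)) a.2.1 b.2.1 else 0) +
                (if a.1.2 = Literature.MathematicalPhysics.QuantumFieldTheory.Site.shift b.1.2 j then
                  (((1 : ℝ) : ℂ) • (1 : Matrix (Fin 4) (Fin 4) ℂ) + euclideanGamma j.succ) a.2.2 b.2.2 *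
                    fundamentalRep (Fin 3) (U ((Fin.cons t b.1.2 : TorusSite 4 L), j.succ))⁻¹ a.2.1 b.2.1 else 0)))
          else 0;
      (diracMatrix U mq - Matrix.reindex quarkEquiv quarkEquiv (Matrix.of fun v w : QuarkVar Nf L =>
          if v.2.1 0 = w.2.1 0 then c (v.2.1 0) * Jh (v.2.1 0) (v.1, (Fin.tail v.2.1, v.2.2)) (w.1, (Fin.tail w.2.1, w.2.2))
          else 0)).det =
        (Matrix.of fun p q : ZMod L × ((Fin Nf × TorusSite 3 L) × Fin 3 × Fin 4) =>
            (if q.1 = p.1 then (A p.1 - c p.1 • Matrix.reindex (Equiv.prodAssoc (Fin Nf) (TorusSite 3 L) (Fin 3 × Fin 4)).symm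
                (Equiv.prodAssoc (Fin Nf) (TorusSite 3 L) (Fin 3 × Fin 4)).symm (Jh p.1)) p.2 q.2 else 0) -
              (if q.1 = p.1 + 1 then (Pm * W p.1) p.2 q.2 else 0) -
              (if p.1 = q.1 + 1 then (Pp * W' q.1) p.2 q.2 else 0)).det := by
  intro Nf L _ U mq c Jh Pp Pm W W' A
  /- (1) Collapsed Kronecker form of the hops `P⁻ · W_t`, `P⁺ · W'_t`:
    `δ_{(f,y),(g,z)} (P∓)_{αβ} ρ(U)_{ab}`. -/
  have hPmW : ∀ t, Pm * W t = Matrix.of fun a b : (Fin Nf × TorusSite 3 L) × Fin 3 × Fin 4 =>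
      if a.1 = b.1 then ((1 / 2 : ℂ) • (1 - euclideanGamma 0)) a.2.2 b.2.2 *
        fundamentalRep (Fin 3) (U ((Fin.cons t a.1.2 : TorusSite 4 L), 0)) a.2.1 b.2.1 else 0 := fun t =>
    TimeSlice.spinLift_mul_colourLift _
      fun x : Fin Nf × TorusSite 3 L => fundamentalRep (Fin 3) (U ((Fin.cons t x.2 : TorusSite 4 L), 0))
  have hPpW' : ∀ t, Pp * W' t = Matrix.of fun a b : (Fin Nf × TorusSite 3 L) × Fin 3 × Fin 4 =>
      if a.1 = b.1 then ((1 / 2 : ℂ) • (1 + euclideanGamma 0)) a.2.2 b.2.2 *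
        fundamentalRep (Fin 3) (U ((Fin.cons t a.1.2 : TorusSite 4 L), 0))⁻¹ a.2.1 b.2.1 else 0 := fun t =>
    TimeSlice.spinLift_mul_colourLift _
      fun x : Fin Nf × TorusSite 3 L => fundamentalRep (Fin 3) (U ((Fin.cons t x.2 : TorusSite 4 L), 0))⁻¹
  /- (2) The Dirac part, entrywise: equal flavours reduce to the one-flavour brick, distinct
    flavours vanish on both sides. -/
  have hD : ∀ (t s' : ZMod L) (f g : Fin Nf) (y z : TorusSite 3 L) (a b : Fin 3) (α β : Fin 4),
      diracMatrix U mq (quarkEquiv (f, ((Fin.cons t y : TorusSite 4 L), a, α)))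
          (quarkEquiv (g, ((Fin.cons s' z : TorusSite 4 L), b, β))) =
        (if s' = t then A t ((f, y), a, α) ((g, z), b, β) else 0) -
          (if s' = t + 1 then (Pm * W t) ((f, y), a, α) ((g, z), b, β) else 0) -
          (if t = s' + 1 then (Pp * W' s') ((f, y), a, α) ((g, z), b, β) else 0) := by
    intro t s' f g y z a b α β
    rw [hPmW, hPpW']
    simp only [diracMatrix, Matrix.reindex_apply, Matrix.submatrix_apply, Equiv.symm_apply_apply,
      Matrix.of_apply, A]
    by_cases hfg : f = g
    · subst hfg
      rw [StubDiracMatrixSourceTimeSlice.wilsonDirac_cons_apply]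
      simp only [if_true, Prod.mk.injEq, true_and]
    · simp only [hfg, if_false, Prod.mk.injEq, false_and, ite_self, sub_zero]
  /- (3) The multi-source part, entrywise (torus side): time-diagonal, coefficient `c t`. -/
  have hJ : ∀ (t s' : ZMod L) (f g : Fin Nf) (y z : TorusSite 3 L) (a b : Fin 3) (α β : Fin 4),
      Matrix.reindex quarkEquiv quarkEquiv (Matrix.of fun v w : QuarkVar Nf L =>
          if v.2.1 0 = w.2.1 0 then
            c (v.2.1 0) * Jh (v.2.1 0) (v.1, (Fin.tail v.2.1, v.2.2)) (w.1, (Fin.tail w.2.1, w.2.2)) else 0)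
          (quarkEquiv (f, ((Fin.cons t y : TorusSite 4 L), a, α)))
          (quarkEquiv (g, ((Fin.cons s' z : TorusSite 4 L), b, β))) =
        if t = s' then c t * Jh t (f, (y, a, α)) (g, (z, b, β)) else 0 := by
    intro t s' f g y z a b α β
    simp only [Matrix.reindex_apply, Matrix.submatrix_apply, Equiv.symm_apply_apply, Matrix.of_apply,
      Fin.cons_zero, Fin.tail_cons]
  /- (4) Reindex along the time/flavour splitting `(t, ((f, y), c)) ↦ quarkEquiv (f, ((t, y), c))`
    (an equivalence, inverse `(f, (x, c)) ↦ (x 0, ((f, Fin.tail x), c))`) and compare entrywise. -/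
  have hdet : ∀ M : Matrix (FermiIdx Nf L) (FermiIdx Nf L) ℂ, M.det =
      (M.submatrix
        (fun p : ZMod L × ((Fin Nf × TorusSite 3 L) × Fin 3 × Fin 4) =>
          quarkEquiv (p.2.1.1, ((Fin.cons p.1 p.2.1.2 : TorusSite 4 L), p.2.2)))
        (fun p : ZMod L × ((Fin Nf × TorusSite 3 L) × Fin 3 × Fin 4) =>
          quarkEquiv (p.2.1.1, ((Fin.cons p.1 p.2.1.2 : TorusSite 4 L), p.2.2)))).det := fun M =>
    (Matrix.det_submatrix_equiv_self
      ((⟨fun p => (p.2.1.1, ((Fin.cons p.1 p.2.1.2 : TorusSite 4 L), p.2.2)),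
          fun v => (v.2.1 0, ((v.1, Fin.tail v.2.1), v.2.2)),
          fun ⟨t, ⟨f, y⟩, c⟩ => by simp, fun ⟨f, x, c⟩ => by simp⟩ :
          ZMod L × ((Fin Nf × TorusSite 3 L) × Fin 3 × Fin 4) ≃ QuarkVar Nf L).trans quarkEquiv) M).symm
  rw [hdet]
  congr 1
  ext ⟨t, ⟨f, y⟩, a, α⟩ ⟨s', ⟨g, z⟩, b, β⟩
  simp only [Matrix.submatrix_apply, Matrix.sub_apply, hD, hJ, Matrix.of_apply]
  simp only [Matrix.smul_apply, smul_eq_mul,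
    StubDiracMatrixMultiSourceTimeSlice.reindex_prodAssoc_symm_apply]
  exact StubDiracMatrixMultiSourceTimeSlice.multiSource_rearrange ⟨Eq.symm, Eq.symm⟩ _ _ _ _

end Summit.QuantumFields.QCD.Cruxes.RobustYangMillsHandover.PinTheInfimum
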